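import Literature.Dynamics.NBody.JensenLeykin2025Roberts
import Mathlib.Tactic
import HarnessLib

/-!
# Dictionary: solutions of Albouy–Kaloshin's system (4) ↦ points of the Jensen–Leykin torus system

For ANY number of bodies `n`, any real masses `m` with total mass `M = Σ m_k`, and any `κ` with
`κ³ M = 1`: if `(q, δ)` is a real normalized central configuration in the sense of
[AlbouyKaloshin2012, Definition 2 / system (4)] (tree file `AlbouyKaloshin2012Roberts.lean`:
`IsRealNormalizedCC m q δ` — `δ_kl = ± r_kl⁻¹` of either sign, `q_k = Σ_l m_l δ_kl³ (q_k − q_l)`),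
then the signed, rescaled reciprocal data `r_ij = κ / δ_ij` (`r_ii = 0`) is a point of the torus
system of [JensenLeykin2025, §2.2–2.3 / §4.1] (tree file `JensenLeykin2025.lean`:
`jlNormalizedCCs ℝ m`).  The computation: with `E_ijk = r_jk² − r_ik² − r_ij² = −2κ² (q_i − q_j)·(q_i − q_k)`,
`g_ij(r)` reduces, using (4) and the centre-of-mass identity `Σ_k m_k q_k = 0` (which follows
from (4) by antisymmetry), to `−2 (q_i − q_j)·q_i (κ⁻¹ − κ² M) = 0`; the Cayley–Menger conditions
hold because `r_ij² = κ² |q_i − q_j|²` are squared distances of planar points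
(`cayleyMenger4_eq_zero_of_planar`).

Consequences: `jl_deltaImage_finite_of_jlFinite` — finiteness of the torus system at `m` implies
finiteness of the set of (signed, rescaled) mutual-distance data of ALL real normalized central
configurations of (4) at `m`; and the Roberts example of `JensenLeykin2025Roberts.lean` is the
instance `m = (1/2,1/2,1/2,1/2,1/8)`, `M = 17/8`, `κ³ = 8/17` of this dictionary.
-/

namespace Literature.Dynamics.NBody

open Finset

/-- The dictionary map: signed rescaled reciprocal inverse-distance data. [folklore] -/
noncomputable def jlOfDelta {n : ℕ} (κ : ℝ) (δ : Fin n → Fin n → ℝ) : Fin n → Fin n → ℝ :=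
  fun i j => if i = j then 0 else κ / δ i j

/-- Centre of mass: every solution of system (4) has `Σ_k m_k x_k = 0` (antisymmetry of the
pairwise terms, `δ` symmetric). [cite: AlbouyKaloshin2012, system (4) p. 540 — derived in-tree] -/
theorem isRealNormalizedCC_sum_mass_mul_fst {n : ℕ} {m : Fin n → ℝ} {q : Fin n → ℝ × ℝ}
    {δ : Fin n → Fin n → ℝ} (h : IsRealNormalizedCC m q δ) : ∑ k, m k * (q k).1 = 0 := by
  have hx : ∀ k, (q k).1 = ∑ l, m l * δ k l ^ 3 * ((q k).1 - (q l).1) := by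
    intro k
    have := congrArg Prod.fst (h.2.2.1 k)
    simpa [Prod.fst_sum, smul_eq_mul] using this
  have hS : ∑ k, m k * (q k).1 = ∑ k, ∑ l, m k * m l * δ k l ^ 3 * ((q k).1 - (q l).1) := by
    refine Finset.sum_congr rfl fun k _ => ?_
    calc m k * (q k).1 = m k * ∑ l, m l * δ k l ^ 3 * ((q k).1 - (q l).1) := by rw [← hx k]
      _ = ∑ l, m k * m l * δ k l ^ 3 * ((q k).1 - (q l).1) := by
          rw [Finset.mul_sum]; exact Finset.sum_congr rfl fun l _ => by ring
  have hanti : ∑ k, ∑ l, m k * m l * δ k l ^ 3 * ((q k).1 - (q l).1)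
      = -(∑ k, ∑ l, m k * m l * δ k l ^ 3 * ((q k).1 - (q l).1)) := by
    conv_rhs => rw [Finset.sum_comm]
    rw [← Finset.sum_neg_distrib]
    refine Finset.sum_congr rfl fun k _ => ?_
    rw [← Finset.sum_neg_distrib]
    refine Finset.sum_congr rfl fun l _ => ?_
    rw [h.1 l k]; ring
  rw [hS]; linarith

/-- Centre of mass, second coordinate. [cite: AlbouyKaloshin2012, system (4) p. 540 — derived in-tree] -/
theorem isRealNormalizedCC_sum_mass_mul_snd {n : ℕ} {m : Fin n → ℝ} {q : Fin n → ℝ × ℝ}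
    {δ : Fin n → Fin n → ℝ} (h : IsRealNormalizedCC m q δ) : ∑ k, m k * (q k).2 = 0 := by
  have hy : ∀ k, (q k).2 = ∑ l, m l * δ k l ^ 3 * ((q k).2 - (q l).2) := by
    intro k
    have := congrArg Prod.snd (h.2.2.1 k)
    simpa [Prod.snd_sum, smul_eq_mul] using this
  have hS : ∑ k, m k * (q k).2 = ∑ k, ∑ l, m k * m l * δ k l ^ 3 * ((q k).2 - (q l).2) := by
    refine Finset.sum_congr rfl fun k _ => ?_
    calc m k * (q k).2 = m k * ∑ l, m l * δ k l ^ 3 * ((q k).2 - (q l).2) := by rw [← hy k]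
      _ = ∑ l, m k * m l * δ k l ^ 3 * ((q k).2 - (q l).2) := by
          rw [Finset.mul_sum]; exact Finset.sum_congr rfl fun l _ => by ring
  have hanti : ∑ k, ∑ l, m k * m l * δ k l ^ 3 * ((q k).2 - (q l).2)
      = -(∑ k, ∑ l, m k * m l * δ k l ^ 3 * ((q k).2 - (q l).2)) := by
    conv_rhs => rw [Finset.sum_comm]
    rw [← Finset.sum_neg_distrib]
    refine Finset.sum_congr rfl fun k _ => ?_
    rw [← Finset.sum_neg_distrib]
    refine Finset.sum_congr rfl fun l _ => ?_
    rw [h.1 l k]; ring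
  rw [hS]; linarith

/-- THE DICTIONARY. Every real normalized central configuration of (4) gives a point of the
Jensen–Leykin torus system after the rescaling `r = κ/δ`, `κ³ Σ m = 1`.
[cite: AlbouyKaloshin2012, system (4) p. 540; JensenLeykin2025, §2.2–2.3 p. 2 — derived in-tree] -/
theorem jlOfDelta_mem_of_isRealNormalizedCC {n : ℕ} (m : Fin n → ℝ) (q : Fin n → ℝ × ℝ)
    (δ : Fin n → Fin n → ℝ) (h : IsRealNormalizedCC m q δ) (κ : ℝ) (hκ0 : κ ≠ 0)
    (hκ : κ ^ 3 * ∑ k, m k = 1) : jlOfDelta κ δ ∈ jlNormalizedCCs ℝ m := by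
  set M := ∑ k, m k with hM
  -- δ_kl ≠ 0 for k ≠ l, and r² = κ² · squared distance
  have hδ0 : ∀ k l, k ≠ l → δ k l ≠ 0 := by
    intro k l hkl hz
    have := h.2.1 k l hkl
    rw [hz] at this; simp at this
  have hr2 : ∀ a b, jlOfDelta κ δ a b ^ 2 = κ ^ 2 * sqDist (q a) (q b) := by
    intro a b
    by_cases hab : a = b
    · subst hab; simp [jlOfDelta, sqDist]
    · have h1 := h.2.1 a b hab
      have hd := hδ0 a b hab
      simp only [jlOfDelta, hab, if_false]
      rw [div_pow]
      field_simp
      linear_combination -h1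
  -- the coordinate equations of (4)
  have hx : ∀ k, (q k).1 = ∑ l, m l * δ k l ^ 3 * ((q k).1 - (q l).1) := by
    intro k
    have := congrArg Prod.fst (h.2.2.1 k)
    simpa [Prod.fst_sum, smul_eq_mul] using this
  have hy : ∀ k, (q k).2 = ∑ l, m l * δ k l ^ 3 * ((q k).2 - (q l).2) := by
    intro k
    have := congrArg Prod.snd (h.2.2.1 k)
    simpa [Prod.snd_sum, smul_eq_mul] using this
  have hc1 := isRealNormalizedCC_sum_mass_mul_fst h
  have hc2 := isRealNormalizedCC_sum_mass_mul_snd h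
  refine ⟨⟨?_, ?_, ?_⟩, ?_, ?_⟩
  · intro i j
    by_cases hij : i = j
    · subst hij; rfl
    · simp only [jlOfDelta, hij, Ne.symm hij, if_false, h.1 i j]
  · intro i; simp [jlOfDelta]
  · intro i j hij
    simp only [jlOfDelta, hij, if_false]
    exact div_ne_zero hκ0 (hδ0 i j hij)
  · intro i j hij
    -- per-term identity
    have hterm : ∀ k, m k * jlS (jlOfDelta κ δ) i k *
        (jlOfDelta κ δ j k ^ 2 - jlOfDelta κ δ i k ^ 2 - jlOfDelta κ δ i j ^ 2)
        = κ⁻¹ * (-2) * (((q i).1 - (q j).1) * (m k * δ i k ^ 3 * ((q i).1 - (q k).1))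
              + ((q i).2 - (q j).2) * (m k * δ i k ^ 3 * ((q i).2 - (q k).2)))
          - κ ^ 2 * (-2) * (((q i).1 - (q j).1) * (m k * ((q i).1 - (q k).1))
              + ((q i).2 - (q j).2) * (m k * ((q i).2 - (q k).2))) := by
      intro k
      rw [hr2 j k, hr2 i k, hr2 i j]
      by_cases hik : i = k
      · subst hik
        simp [jlS, sqDist]
      · have hd := hδ0 i k hik
        simp only [jlS, jlOfDelta, hik, if_false, sqDist]
        rw [inv_div, div_pow]
        field_simp
        ring
    unfold jlG
    rw [Finset.sum_congr rfl fun k _ => hterm k]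
    simp only [Finset.sum_sub_distrib, Finset.sum_add_distrib, ← Finset.mul_sum]
    -- the four inner sums
    have s1 : ∑ k, m k * δ i k ^ 3 * ((q i).1 - (q k).1) = (q i).1 := (hx i).symm
    have s2 : ∑ k, m k * δ i k ^ 3 * ((q i).2 - (q k).2) = (q i).2 := (hy i).symm
    have s3 : ∑ k, m k * ((q i).1 - (q k).1) = M * (q i).1 := by
      simp only [mul_sub, Finset.sum_sub_distrib, ← Finset.sum_mul, hc1, hM]; ring
    have s4 : ∑ k, m k * ((q i).2 - (q k).2) = M * (q i).2 := by
      simp only [mul_sub, Finset.sum_sub_distrib, ← Finset.sum_mul, hc2, hM]; ring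
    rw [s1, s2, s3, s4]
    have hinv : κ⁻¹ = κ ^ 2 * M := by
      field_simp
      linear_combination -hκ
    rw [hinv]; ring
  · intro a b c d _ _ _ _ _ _
    refine cayleyMenger4_eq_zero_of_planar _ (fun k => κ * (q k).1) (fun k => κ * (q k).2) ?_ a b c d
    intro a' b'
    rw [hr2 a' b']
    simp only [sqDist]
    ring

/-- COROLLARY (finiteness transfer, torus ⇒ (4)): if the torus system is finite at `m` then the
set of signed rescaled distance data of all real normalized central configurations of (4) at `m`
is finite. [cite: JensenLeykin2025, §2.4 p. 3; AlbouyKaloshin2012, Definition 2 p. 540 — derived in-tree] -/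
theorem jl_deltaImage_finite_of_jlFinite {n : ℕ} (m : Fin n → ℝ) (κ : ℝ) (hκ0 : κ ≠ 0)
    (hκ : κ ^ 3 * ∑ k, m k = 1) (hfin : (jlNormalizedCCs ℝ m).Finite) :
    ((fun c : (Fin n → ℝ × ℝ) × (Fin n → Fin n → ℝ) => jlOfDelta κ c.2) ''
        realNormalizedCCs m).Finite := by
  refine hfin.subset ?_
  rintro _ ⟨c, hc, rfl⟩
  exact jlOfDelta_mem_of_isRealNormalizedCC m c.1 c.2 hc κ hκ0 hκ

/-- The Roberts instance of the dictionary: total mass `17/8` (so `κ³ = 8/17`).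
[cite: AlbouyKaloshin2012, p. 543 — derived in-tree] -/
theorem robertsMasses_sum : ∑ k, robertsMasses k = 17 / 8 := by
  simp [robertsMasses, Fin.sum_univ_five]; norm_num

end Literature.Dynamics.NBody
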